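import Summits.BirchSwinnertonDyer.BirchSwinnertonDyer.Theorems.AlignedTransportAtTwoMainConjectureOfRankZeroBSDAtTwoFineRoadLambdaModP
import Summits.BirchSwinnertonDyer.BirchSwinnertonDyer.Theorems.AlignedTransportAtTwoMainConjectureOfRankZeroBSDAtTwoFineRoadLocalArch
import Literature.NumberTheory.EllipticCurves.GreenbergArchimedeanSelmerFactorAtTwo
import Literature.NumberTheory.EllipticCurves.IwasawaAlgebraCharIdealProofs
import Mathlib.Algebra.Module.CharacterModule
import Mathlib.Algebra.Module.ZMod
import Mathlib.LinearAlgebra.Dual.Lemmas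
import HarnessLib

/-!
# Road (b″) netted, the archimedean extension `q : X^{rel ∞} ↠ X` — receptacle-free Pontryagin packaging:
# `q` is onto, `ker q = (Sel^{rel ∞}/Sel)^∨` is killed by `2`, is INFINITE when `Sel^{rel ∞}/Sel` is, and then
# `1 ≤ ℓ₍₂₎(ker q)` for every finitely generated pinned dual `Xr` (Greenberg L.4.6 ⟹ `e = [Δ_E > 0] ≤ ℓ₍₂₎(ker q)`)

Cell `bsd-f1-sign2`, WIDTH-5 attach seat `bsd-line-att-p4` (gen 4) on line `birth` of crux C2
stmt-BirchSwinnertonDyer-22298 `MainConjectureOfRankZeroBSDAtTwo`; a `--supports 22298 --as helper` file. HONEST FRAMING: THEOREMS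
ONLY — no definition, no named fact, no `sorry`; BSD is NOT proved by any of this. Greenberg's Lemma 4.6 enters as the HYPOTHESIS
`Greenberg1999.lemma46_relaxed_mod_selmer_infinite_rat_two` (typed fact, -ty g7 p608868) in §3 only.

WHY. The displayed `KatoNetDataRelAtTwo` (K₂ⁿᵉᵗʳ) quantifies the dual `Xr` of `Sel^{rel ∞}(ℚ_∞)` existentially and asks for an
archimedean extension `q : Xr ↠ D.X` with `e ≤ ℓ₍₂₎(ker q)`. No receptacle for `Xr` is fixed in the tree (-ty: «on ask»). This file
proves everything about `q` that does NOT depend on the receptacle's `Λ`-action axioms, for ANY additive bijection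
`toDualR : Xr ≃ Hom(R, ℚ/ℤ)` and ANY `Λ`-linear `q` compatible with `D.toDual` — so that whichever receptacle the typer fixes, the
conjunct follows by instantiation:

* §1 (abstract: `S ≤ R ≤ A`, pinned duals `X ≅ Hom(S, ℚ/ℤ)`, `Xr ≅ Hom(R, ℚ/ℤ)`, additive `q` with `toDual (q x) = toDualR x ∘ ι`)
  `surjective_of_compat` (Baer: `ℚ/ℤ` divisible), `apply_eq_zero_iff` (`ker q` = characters vanishing on `S`),
  `two_nsmul_eq_zero_of_apply_eq_zero` (`2R ≤ S ⟹ 2 · ker q = 0`), `infinite_addMonoidHom_addCircle` (an INFINITE group killed by `2`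
  has infinitely many characters: `𝔽₂`-duality, Mathlib `Module.finite_dual_iff`), `infinite_ker_of_infinite_quotient`.
* §2 (`Λ = ℤ₂⟦T⟧`-linear `q`, `Xr` finitely generated) **`one_le_lengthAt_ker_of_infinite_quotient`**: `2R ≤ S` and `R/S` infinite ⟹
  `1 ≤ ℓ₍₂₎(ker q)` (by `LambdaModP.one_le_lengthAt_two_of_infinite`); `injective_of_le` (`R ≤ S ⟹ q` injective).
* §3 (the tree's objects: `S = Sel_{2^∞}(E/ℚ_∞)`, `R = Greenberg1999.relaxedSelmerInftyAtTwo W κ`, `X = D.X`)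
  **`one_le_lengthAt_ker_archExtension`**: GRANTED Greenberg L.4.6 at 2 (the typed fact), for `W` good ordinary at `2` with `Δ_W > 0`,
  `κ` cyclotomic with generator `γ`, `D` torsion: every finitely generated pinned dual `Xr` of `Sel^{rel ∞}` and every compatible
  `Λ`-linear `q : Xr → D.X` has `1 ≤ ℓ₍₂₎(ker q)` — the conjunct `e ≤ ℓ₍₂₎(ker q)`, `e = 1`, of K₂ⁿᵉᵗʳ; and
  `archExtension_injective_of_Δ_neg`: for `Δ_W < 0`, `q` is injective (`Sel^{rel ∞} = Sel`, att-p4 g3 `LocalArch`), `e = 0`.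

References: R. Greenberg, LNM 1716 (1999), §1 p. 60, §4 Lemma 4.6 + Remark (PDF pp. 105–107); L. Washington, *Cyclotomic Fields* §13.2.
-/

set_option autoImplicit false
-- the Theorems namespace of this sub repeats the summit name by design (D-0017 nested layout)
set_option linter.dupNamespace false

noncomputable section

open scoped Classical

namespace Summit.BirchSwinnertonDyer.BirchSwinnertonDyer.Theorems.AlignedTransportAtTwoFineRoad.ArchKernel

open Literature.NumberTheory.EllipticCurves Literature.NumberTheory.EllipticCurves.IwasawaAlgebra
  Literature.NumberTheory.EllipticCurves.Module

/-! ## §1 Abstract Pontryagin packaging of a restriction-dual `q` -/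

section Abstract

variable {A : Type*} [AddCommGroup A] {S R : AddSubgroup A} (hSR : S ≤ R)
  {X Xr : Type*} [AddCommGroup X] [AddCommGroup Xr]
  (toDual : X →+ (S →+ AddCircle (1 : ℚ))) (toDualR : Xr →+ (R →+ AddCircle (1 : ℚ)))
  (q : Xr →+ X)

/-- **`q` is ONTO**: every character of `S` extends to `R` along the injective inclusion (`ℚ/ℤ` is divisible — Mathlib
`CharacterModule.dual_surjective_of_injective`), and `toDualR` is onto. [cite: GreenbergLNM1716, §1 (after Conj. 1.3)] -/
theorem surjective_of_compat (hD : Function.Bijective toDual) (hR : Function.Bijective toDualR)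
    (hq : ∀ (x : Xr) (s : S), toDual (q x) s = toDualR x (AddSubgroup.inclusion hSR s)) :
    Function.Surjective q := by
  intro y
  set ι : S →+ R := AddSubgroup.inclusion hSR with hι
  have hinj : Function.Injective ι.toIntLinearMap := AddSubgroup.inclusion_injective hSR
  obtain ⟨L, hL⟩ := CharacterModule.dual_surjective_of_injective (R := ℤ) ι.toIntLinearMap hinj
    (toDual y : CharacterModule S)
  obtain ⟨x, hx⟩ := hR.surjective (L : R →+ AddCircle (1 : ℚ))
  refine ⟨x, hD.injective (AddMonoidHom.ext fun s ↦ ?_)⟩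
  rw [hq, hx]
  have := congrArg (fun χ : CharacterModule S ↦ χ s) hL
  simp only [CharacterModule.dual_apply] at this
  exact this

/-- **`ker q` = the characters of `R` vanishing on `S`** (the Pontryagin dual of `R/S`). [cite: GreenbergLNM1716, §4 Lemma 4.6] -/
theorem apply_eq_zero_iff (hD : Function.Bijective toDual)
    (hq : ∀ (x : Xr) (s : S), toDual (q x) s = toDualR x (AddSubgroup.inclusion hSR s)) (x : Xr) :
    q x = 0 ↔ ∀ s : S, toDualR x (AddSubgroup.inclusion hSR s) = 0 := by
  constructor
  · intro h s
    rw [← hq, h, map_zero, AddMonoidHom.zero_apply]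
  · intro h
    have h0 : toDual (q x) = toDual 0 := by
      rw [map_zero]
      exact AddMonoidHom.ext fun s ↦ by rw [hq, h, AddMonoidHom.zero_apply]
    exact hD.injective h0

/-- **`2R ≤ S ⟹ ker q` is killed by `2`**: a character vanishing on `S ⊇ 2R` is killed by `2`.
[cite: GreenbergLNM1716, §4 (PDF pp. 106–107)] -/
theorem two_nsmul_eq_zero_of_apply_eq_zero (hD : Function.Bijective toDual) (hR : Function.Bijective toDualR)
    (hq : ∀ (x : Xr) (s : S), toDual (q x) s = toDualR x (AddSubgroup.inclusion hSR s))
    (h2 : ∀ r : R, (2 : ℕ) • (r : A) ∈ S) {x : Xr} (hx : q x = 0) : (2 : ℕ) • x = 0 := by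
  rw [apply_eq_zero_iff hSR toDual toDualR q hD hq] at hx
  apply hR.injective
  rw [map_nsmul, map_zero]
  ext r
  rw [AddMonoidHom.nsmul_apply, AddMonoidHom.zero_apply, ← map_nsmul]
  have e : (2 : ℕ) • r = AddSubgroup.inclusion hSR ⟨(2 : ℕ) • (r : A), h2 r⟩ := Subtype.ext rfl
  rw [e]
  exact hx _

/-- **An infinite group killed by `2` has infinitely many characters** `→ ℚ/ℤ`: it is an infinite-dimensional
`𝔽₂`-vector space, so its `𝔽₂`-dual is not finitely generated (Mathlib `Module.finite_dual_iff`), and `𝔽₂`-linear forms embed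
into characters via `𝔽₂ = ½ℤ/ℤ ↪ ℚ/ℤ`. [folklore] -/
theorem infinite_addMonoidHom_addCircle {B : Type*} [AddCommGroup B] [Infinite B] (h2 : ∀ b : B, (2 : ℕ) • b = 0) :
    Infinite (B →+ AddCircle (1 : ℚ)) := by
  letI : _root_.Module (ZMod 2) B := AddCommGroup.zmodModule h2
  -- the embedding `e : ℤ/2 ↪ ℚ/ℤ`, `1 ↦ 1/2`
  let f : ℤ →+ AddCircle (1 : ℚ) := zmultiplesHom (AddCircle (1 : ℚ)) (((1 / 2 : ℚ) : AddCircle (1 : ℚ)))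
  have hf2 : f 2 = 0 := by
    change (2 : ℤ) • (((1 / 2 : ℚ) : AddCircle (1 : ℚ))) = 0
    rw [← AddCircle.coe_zsmul, show (2 : ℤ) • (1 / 2 : ℚ) = 1 by norm_num]
    exact AddCircle.coe_period (1 : ℚ)
  let e : ZMod 2 →+ AddCircle (1 : ℚ) := ZMod.lift 2 ⟨f, hf2⟩
  have he : Function.Injective e := by
    refine (ZMod.lift_injective (n := 2) (f := ⟨f, hf2⟩)).mpr fun m hm ↦ ?_
    change (m : ℤ) • (((1 / 2 : ℚ) : AddCircle (1 : ℚ))) = 0 at hm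
    rw [← AddCircle.coe_zsmul, AddCircle.coe_eq_zero_iff] at hm
    obtain ⟨k, hk⟩ := hm
    rw [zsmul_eq_mul, mul_one, zsmul_eq_mul] at hk
    have hk' : (m : ℚ) = 2 * k := by linarith
    have hm2 : (m : ℤ) = 2 * k := by exact_mod_cast hk'
    rw [ZMod.intCast_zmod_eq_zero_iff_dvd]
    exact ⟨k, hm2⟩
  -- `𝔽₂`-linear forms ↪ characters
  have hΦ : Function.Injective fun φ : Module.Dual (ZMod 2) B ↦ e.comp φ.toAddMonoidHom := by
    intro φ ψ hφψ
    apply LinearMap.ext fun b ↦ he ?_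
    exact congrArg (fun χ : B →+ AddCircle (1 : ℚ) ↦ χ b) hφψ
  by_contra hfin
  rw [not_infinite_iff_finite] at hfin
  haveI : Finite (Module.Dual (ZMod 2) B) := Finite.of_injective _ hΦ
  haveI : Module.Finite (ZMod 2) (Module.Dual (ZMod 2) B) := Module.Finite.of_finite
  haveI : Module.Finite (ZMod 2) B := (Module.finite_dual_iff (ZMod 2)).mp inferInstance
  haveI : Finite B := Module.finite_of_finite (ZMod 2)
  exact not_finite B

/-- **If `R/S` is infinite (and `2R ≤ S`), `ker q` is infinite**: the characters of `R/S` are infinitely many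
(`infinite_addMonoidHom_addCircle`) and, pulled back to `R` and through `toDualR⁻¹`, give distinct elements of `ker q`.
[cite: GreenbergLNM1716, §4 Lemma 4.6 and Remark (PDF pp. 105–107)] -/
theorem infinite_ker_of_infinite_quotient (hD : Function.Bijective toDual) (hR : Function.Bijective toDualR)
    (hq : ∀ (x : Xr) (s : S), toDual (q x) s = toDualR x (AddSubgroup.inclusion hSR s))
    (h2 : ∀ r : R, (2 : ℕ) • (r : A) ∈ S) [hinf : Infinite (R ⧸ S.addSubgroupOf R)] :
    Infinite {x : Xr // q x = 0} := by
  have h2' : ∀ b : R ⧸ S.addSubgroupOf R, (2 : ℕ) • b = 0 := by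
    intro b
    induction b using QuotientAddGroup.induction_on with
    | H r =>
      rw [← QuotientAddGroup.mk_nsmul, QuotientAddGroup.eq_zero_iff, AddSubgroup.mem_addSubgroupOf]
      exact h2 r
  haveI := infinite_addMonoidHom_addCircle h2'
  set eR := AddEquiv.ofBijective toDualR hR with heR
  -- character of `R/S` ↦ element of `ker q`
  refine Infinite.of_injective (fun χ : (R ⧸ S.addSubgroupOf R) →+ AddCircle (1 : ℚ) ↦
    (⟨eR.symm (χ.comp (QuotientAddGroup.mk' (S.addSubgroupOf R))), ?_⟩ : {x : Xr // q x = 0})) ?_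
  · rw [apply_eq_zero_iff hSR toDual toDualR q hD hq]
    intro s
    have happ : toDualR (eR.symm (χ.comp (QuotientAddGroup.mk' (S.addSubgroupOf R)))) =
        χ.comp (QuotientAddGroup.mk' (S.addSubgroupOf R)) := eR.apply_symm_apply _
    rw [happ, AddMonoidHom.comp_apply, QuotientAddGroup.mk'_apply,
      (QuotientAddGroup.eq_zero_iff _).mpr (AddSubgroup.mem_addSubgroupOf.mpr (by exact s.2)), map_zero]
  · intro χ χ' h
    have h1 := congrArg (fun y : {x : Xr // q x = 0} ↦ (y : Xr)) h
    dsimp only at h1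
    have h2c : χ.comp (QuotientAddGroup.mk' (S.addSubgroupOf R)) = χ'.comp (QuotientAddGroup.mk' (S.addSubgroupOf R)) :=
      eR.symm.injective h1
    exact AddMonoidHom.ext fun b ↦ QuotientAddGroup.induction_on b fun r ↦
      congrArg (fun ψ : R →+ AddCircle (1 : ℚ) ↦ ψ r) h2c

end Abstract

/-! ## §2 The `Λ`-linear case: `1 ≤ ℓ₍₂₎(ker q)` once `Xr` is finitely generated and `R/S` is infinite -/

section Lambda

variable {A : Type*} [AddCommGroup A] {S R : AddSubgroup A} (hSR : S ≤ R)
  {X Xr : Type*} [AddCommGroup X] [_root_.Module (IwasawaAlgebra 2) X] [AddCommGroup Xr]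
  [_root_.Module (IwasawaAlgebra 2) Xr]
  (toDual : X →+ (S →+ AddCircle (1 : ℚ))) (toDualR : Xr →+ (R →+ AddCircle (1 : ℚ)))
  (q : Xr →ₗ[IwasawaAlgebra 2] X)

/-- **`1 ≤ ℓ₍₂₎(ker q)`**: for `Λ = ℤ₂⟦T⟧`-modules `X ≅ Hom(S, ℚ/ℤ)`, `Xr ≅ Hom(R, ℚ/ℤ)` (additive bijections), `Xr` finitely
generated, and a `Λ`-linear `q` dual to `S ≤ R` with `2R ≤ S` and `R/S` INFINITE: `ker q` is an infinite finitely generated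
`Λ`-module killed by `2`, so `ℓ₍₂₎(ker q) ≥ 1` (`LambdaModP.one_le_lengthAt_two_of_infinite`).
[cite: GreenbergLNM1716, §4 Lemma 4.6 and Remark (PDF pp. 105–107)] [cite: Washington1997, §13.2] -/
theorem one_le_lengthAt_ker_of_infinite_quotient [Module.Finite (IwasawaAlgebra 2) Xr]
    (hD : Function.Bijective toDual) (hR : Function.Bijective toDualR)
    (hq : ∀ (x : Xr) (s : S), toDual (q x) s = toDualR x (AddSubgroup.inclusion hSR s))
    (h2 : ∀ r : R, (2 : ℕ) • (r : A) ∈ S) [Infinite (R ⧸ S.addSubgroupOf R)] :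
    1 ≤ lengthAt (IwasawaAlgebra 2) (LinearMap.ker q) ⟨augIdealP 2, isPrime_augIdealP_holds 2⟩ := by
  haveI : Infinite (LinearMap.ker q) := by
    haveI := infinite_ker_of_infinite_quotient hSR toDual toDualR q.toAddMonoidHom hD hR hq h2
    exact Infinite.of_injective (fun y : {x : Xr // q.toAddMonoidHom x = 0} ↦
      (⟨y.1, LinearMap.mem_ker.mpr y.2⟩ : LinearMap.ker q)) fun y y' h ↦ Subtype.ext (congrArg Subtype.val h)
  refine LambdaModP.one_le_lengthAt_two_of_infinite fun n ↦ Subtype.ext ?_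
  rw [Submodule.coe_smul_of_tower, Submodule.coe_zero]
  exact two_nsmul_eq_zero_of_apply_eq_zero hSR toDual toDualR q.toAddMonoidHom hD hR hq h2
    (LinearMap.mem_ker.mp n.2)

omit [_root_.Module (IwasawaAlgebra 2) X] [_root_.Module (IwasawaAlgebra 2) Xr] in
/-- **`R ≤ S ⟹ q` injective** (a character of `R = S` vanishing on `S` is zero): the archimedean extension is an ISOMORPHISM
whenever the relaxed and strict groups agree. [cite: GreenbergLNM1716, §4 (PDF p. 106: «usually this group is zero»)] -/
theorem injective_of_le (q : Xr →+ X) (hD : Function.Bijective toDual) (hR : Function.Bijective toDualR)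
    (hq : ∀ (x : Xr) (s : S), toDual (q x) s = toDualR x (AddSubgroup.inclusion hSR s)) (hRS : R ≤ S) :
    Function.Injective q := by
  refine (injective_iff_map_eq_zero q).mpr fun x hx ↦ hR.injective ?_
  rw [map_zero]
  ext r
  rw [AddMonoidHom.zero_apply]
  have e : r = AddSubgroup.inclusion hSR ⟨(r : A), hRS r.2⟩ := Subtype.ext rfl
  rw [e]
  exact (apply_eq_zero_iff hSR toDual toDualR q hD hq x).mp hx _

end Lambda

/-! ## §3 The archimedean extension of road (b″): `e = [Δ_W > 0] ≤ ℓ₍₂₎(ker q)` -/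

section Arch

open WeierstrassCurve Literature.NumberTheory.EllipticCurves.Greenberg1999

variable (W : WeierstrassCurve ℚ) [W.IsElliptic] {κ : ZpExtension ℚ 2} {γ : Field.absoluteGaloisGroup ℚ}

omit [W.IsElliptic] in
/-- `2 · Sel^{rel ∞} ≤ Sel` over `ℚ_∞` at `p = 2` (att-p4 g3 `LocalArch.two_nsmul_mem_selmerGroupOver_of_mem_relaxed`, restated for
`Greenberg1999.relaxedSelmerInftyAtTwo`). [cite: GreenbergLNM1716, §4 Remark after Lemma 4.6 (PDF p. 106)] -/
theorem two_nsmul_mem_selmerInfty_of_mem_relaxed [W.IsElliptic] (r : relaxedSelmerInftyAtTwo W κ) :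
    (2 : ℕ) • (r : W.subgroupH1 2 κ.kerSubgroup) ∈ W.selmerInfty κ :=
  LocalArch.two_nsmul_mem_selmerGroupOver_of_mem_relaxed W κ.kerSubgroup r.2

/-- **`e = 1 ≤ ℓ₍₂₎(ker q)` for `Δ_W > 0`, GRANTED Greenberg L.4.6 at `2`.** For `W/ℚ` globally minimal, elliptic, good ordinary
at `2` with `0 < Δ_W`, the cyclotomic `ℤ₂`-extension `κ` with topological generator `γ`, a TORSION pinned dual `D` of
`Sel_{2^∞}(E/ℚ_∞)`, ANY finitely generated `Λ`-module `Xr` pinned to `Sel^{rel ∞}(ℚ_∞) = relaxedSelmerInftyAtTwo W κ` by an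
additive bijection `toDualR`, and ANY `Λ`-linear `q : Xr → D.X` with `D.toDual (q x) = toDualR x ∘ ι`: `1 ≤ ℓ₍₂₎(ker q)`. The typed
fact gives `Sel^{rel ∞}/Sel` infinite; `2·Sel^{rel ∞} ≤ Sel`; then §2. This is the archimedean conjunct of K₂ⁿᵉᵗʳ with
`e = [Δ_W > 0] = 1`, for whichever receptacle supplies `(Xr, toDualR, q)`. CONDITIONAL on the named fact.
[cite: GreenbergLNM1716, §4 Lemma 4.6 and Remark (PDF pp. 105–107)] -/
theorem one_le_lengthAt_ker_archExtension (h46 : lemma46_relaxed_mod_selmer_infinite_rat_two)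
    [W.IsGloballyMinimal] (hord : IsOrdinaryAt W 2) (hΔ : 0 < W.Δ) (hκ : κ.IsCyclotomic) (hγ : κ.IsTopGenerator γ)
    (D : W.SelmerDualData κ γ) (hD : D.IsTorsion)
    {Xr : Type*} [AddCommGroup Xr] [_root_.Module (IwasawaAlgebra 2) Xr] [Module.Finite (IwasawaAlgebra 2) Xr]
    (toDualR : Xr →+ (relaxedSelmerInftyAtTwo W κ →+ AddCircle (1 : ℚ))) (hR : Function.Bijective toDualR)
    (q : Xr →ₗ[IwasawaAlgebra 2] D.X)
    (hq : ∀ (x : Xr) (s : W.selmerInfty κ),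
      D.toDual (q x) s = toDualR x (AddSubgroup.inclusion (selmerInfty_le_relaxedSelmerInftyAtTwo W κ) s)) :
    1 ≤ lengthAt (IwasawaAlgebra 2) (LinearMap.ker q) ⟨augIdealP 2, isPrime_augIdealP_holds 2⟩ := by
  haveI := h46 W hord hΔ κ γ hκ hγ D hD
  exact one_le_lengthAt_ker_of_infinite_quotient (selmerInfty_le_relaxedSelmerInftyAtTwo W κ) D.toDual toDualR q
    D.bijective hR hq (fun r ↦ two_nsmul_mem_selmerInfty_of_mem_relaxed W r)

/-- **`Δ_W < 0`: the archimedean extension is injective (`e = 0`)** — `Sel^{rel ∞}(ℚ_∞) = Sel(ℚ_∞)`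
(`LocalArch.relaxed_eq_selmerGroupOver_of_Δ_neg`), so `ker q = 0`, unconditionally. [cite: GreenbergLNM1716, §4 (PDF p. 106)] -/
theorem archExtension_injective_of_Δ_neg (hΔ : W.Δ < 0) (D : W.SelmerDualData κ γ)
    {Xr : Type*} [AddCommGroup Xr] (toDualR : Xr →+ (relaxedSelmerInftyAtTwo W κ →+ AddCircle (1 : ℚ)))
    (hR : Function.Bijective toDualR) (q : Xr →+ D.X)
    (hq : ∀ (x : Xr) (s : W.selmerInfty κ),
      D.toDual (q x) s = toDualR x (AddSubgroup.inclusion (selmerInfty_le_relaxedSelmerInftyAtTwo W κ) s)) :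
    Function.Injective q :=
  injective_of_le (selmerInfty_le_relaxedSelmerInftyAtTwo W κ) D.toDual toDualR q D.bijective hR hq
    (le_of_eq (LocalArch.relaxed_eq_selmerGroupOver_of_Δ_neg W κ.kerSubgroup hΔ))

end Arch

end Summit.BirchSwinnertonDyer.BirchSwinnertonDyer.Theorems.AlignedTransportAtTwoFineRoad.ArchKernel

end
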